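import Summits.AnomalousDissipation.AnomalousDissipation.Theorems.SolenoidalFractalHomogenisationLagrangianStepOneLevelSplitDefs
import Literature.Analysis.FunctionSpaces.TorusFluidGlueProofs
import Literature.Analysis.FunctionSpaces.TorusTimeAverage
import HarnessLib

/-!
# K1L_D `LagrangianRenormalisationStepDesign` (stmt-AnomalousDissipation-27980), stub `stub_oneLevelL_IW` v3: the elementary API of the one-level split
# data (helper; `--supports stmt-AnomalousDissipation-27980 --as helper`)

Sorry-free elementary facts about the shared data definitions `V2 datumLp grid cutLp vSeq uSeq` of `…LagrangianStepOneLevelSplitDefs` (tenure D24-8 (a)),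
namespace `…Theorems.SolenoidalFractalHomogenisation.LagrangianStep.OneLevelSplit`, used by the glue `…LagrangianStepOneLevelSplitGlue` (D24-8 (b)) and
offered to the provers of S23′ `stub_windowDefectL` / S3d′ `stub_fastContentL`:
* the grid: `grid_zero`, `grid_le`, `grid_nonneg`, `grid_mono`, `grid_eq_of_le`, `grid_floor_succ` (`grid r t (⌊t/r⌋₊+1) = t`);
* norms on `V2`: `norm_sq_eq_integral`, `norm_toLp_sq`, `rho_le_one` / `rho_nonneg` (the ratio `N_m/N_{m+1}` under `N_m² ≤ N_{m+1}`);
* the ledger sequences: `vSeq_zero/succ`, `uSeq_zero/succ` (`rfl` simp lemmas);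
* the cut `cutLp N` = `Torus.fourierTruncate N` a.e. (`coeFn_cutLp`): Bessel `norm_cutLp_sq_le` / `norm_cutLp_le`, no modes outside the ball
  (`mFourierCoeff_cutLp_eq_zero`), orthogonal-projection identity `inner_cutLp_self : ⟪y, P y⟫ = ‖P y‖²`, Pythagoras `norm_sub_cutLp_sq`, the Plancherel
  split `norm_sq_eq_cut_split : ‖y‖² = ‖P y‖² + ‖y − P y‖²` (the form of S3d′), and `isWeaklyDivFree_cutLp` (RRS 2016 Lemma 2.9 via
  `Torus.isDivFree_fourierTruncate` + `IsDivFree.isWeaklyDivFree_holds` + `IsWeaklyDivFree.congr_ae`);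
* the datum: `coeFn_datumLp`, `norm_datumLp_sq : ‖datumLp w₀ hw₀‖² = vectorL2Sq w₀`, `isWeaklyDivFree_datumLp`.
WHAT THIS IS NOT: not a proof of any stub, of the crux K1L_D, of Onsager's conjecture or of anomalous dissipation; rung F-D1.A0 infrastructure.
Text by planner seat `ad-ideate-p4` g11 (2026-08-28); landed by a prover seat (Summits/Theorems is prover-only, D-0016).
-/

set_option linter.dupNamespace false

namespace Summit.AnomalousDissipation.AnomalousDissipation.Theorems.SolenoidalFractalHomogenisation.LagrangianStep

open Literature.Analysis Literature.Analysis.FluidPDE Literature.Analysis.FunctionSpaces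
open MeasureTheory Set Filter
open scoped ENNReal NNReal InnerProductSpace

noncomputable section

namespace OneLevelSplit

/-! ## The grid, norms on `V2`, the ratio `ρ` -/

/-- The grid starts at `0`. -/
theorem grid_zero {r t : ℝ} (ht : 0 ≤ t) : grid r t 0 = 0 := by
  simp [grid, min_eq_left ht]

/-- Every grid point is `≤ t`. -/
theorem grid_le (r t : ℝ) (j : ℕ) : grid r t j ≤ t := min_le_right _ _

/-- Grid points are nonnegative. -/
theorem grid_nonneg {r t : ℝ} (hr : 0 ≤ r) (ht : 0 ≤ t) (j : ℕ) : 0 ≤ grid r t j :=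
  le_min (mul_nonneg (Nat.cast_nonneg j) hr) ht

/-- The grid is monotone. -/
theorem grid_mono {r : ℝ} (hr : 0 ≤ r) (t : ℝ) (j : ℕ) : grid r t j ≤ grid r t (j + 1) :=
  min_le_min (mul_le_mul_of_nonneg_right (by exact_mod_cast Nat.le_succ j) hr) le_rfl

/-- Beyond `t / r` the grid is constant `= t`. -/
theorem grid_eq_of_le {r t : ℝ} {j : ℕ} (h : t ≤ (j : ℝ) * r) : grid r t j = t := min_eq_right h

/-- `grid (⌊t/r⌋₊ + 1) = t`. -/
theorem grid_floor_succ {r t : ℝ} (hr : 0 < r) : grid r t (⌊t / r⌋₊ + 1) = t := by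
  apply grid_eq_of_le
  have h := Nat.lt_floor_add_one (t / r)
  rw [div_lt_iff₀ hr] at h
  exact_mod_cast h.le

/-- `‖y‖² = ∫‖y‖²` on `V2`. -/
theorem norm_sq_eq_integral (y : V2) : ‖y‖ ^ 2 = ∫ x, ‖(y : VF) x‖ ^ 2 := by
  rw [← real_inner_self_eq_norm_sq, MeasureTheory.L2.inner_def]
  exact integral_congr_ae (Eventually.of_forall fun x => real_inner_self_eq_norm_sq _)

/-- `‖toLp f‖² = ∫‖f‖²`. -/
theorem norm_toLp_sq {f : VF} (hf : MemLp f 2 volume) : ‖hf.toLp f‖ ^ 2 = ∫ x, ‖f x‖ ^ 2 := by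
  rw [norm_sq_eq_integral]
  exact integral_congr_ae (hf.coeFn_toLp.mono fun x hx => by simp only [hx])

/-- The scale ratio is `≤ 1`. -/
theorem rho_le_one {a b : ℕ} (h : a ^ 2 ≤ b) : (a : ℝ) / b ≤ 1 := by
  rcases Nat.eq_zero_or_pos b with hb | hb
  · simp [hb]
  · rw [div_le_one (by exact_mod_cast hb)]
    exact_mod_cast (Nat.le_self_pow two_ne_zero a).trans h

/-- The scale ratio is `≥ 0`. -/
theorem rho_nonneg (a b : ℕ) : 0 ≤ (a : ℝ) / b := by positivity

/-! ## The `cutLp` / `datumLp` / ledger-sequence API (sorry-free) -/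

/-- `vSeq` at `0` is the datum. -/
theorem vSeq_zero (Um : ℝ → ℝ → (V2 →L[ℝ] V2)) (w0L : V2) (r t : ℝ) : vSeq Um w0L r t 0 = w0L := rfl

/-- `vSeq` at `j+1` is the propagated datum. -/
theorem vSeq_succ (Um : ℝ → ℝ → (V2 →L[ℝ] V2)) (w0L : V2) (r t : ℝ) (j : ℕ) :
    vSeq Um w0L r t (j + 1) = Um 0 (grid r t (j + 1)) w0L := rfl

/-- `uSeq` at `0` is the datum. -/
theorem uSeq_zero (Um1 : ℝ → ℝ → (V2 →L[ℝ] V2)) (w0L : V2) (N : ℕ) (r t : ℝ) : uSeq Um1 w0L N r t 0 = w0L := rfl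

/-- `uSeq` at `j+1` is the cut propagated datum. -/
theorem uSeq_succ (Um1 : ℝ → ℝ → (V2 →L[ℝ] V2)) (w0L : V2) (N : ℕ) (r t : ℝ) (j : ℕ) :
    uSeq Um1 w0L N r t (j + 1) = cutLp N (Um1 0 (grid r t (j + 1)) w0L) := rfl

/-- The cut is the Fourier truncation, a.e. -/
theorem coeFn_cutLp (N : ℕ) (y : V2) : ((cutLp N y : V2) : VF) =ᵐ[volume] Torus.fourierTruncate N (y : VF) :=
  MemLp.coeFn_toLp _

/-- `‖cutLp N y‖²` as a mode sum (Parseval on the cut). -/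
theorem norm_cutLp_sq (N : ℕ) (y : V2) : ‖cutLp N y‖ ^ 2 = ∫ x, ‖Torus.fourierTruncate N (y : VF) x‖ ^ 2 :=
  norm_toLp_sq _

/-- Bessel: the cut does not increase the energy. -/
theorem norm_cutLp_sq_le (N : ℕ) (y : V2) : ‖cutLp N y‖ ^ 2 ≤ ‖y‖ ^ 2 := by
  rw [norm_cutLp_sq, norm_sq_eq_integral]
  exact Torus.integral_norm_sq_fourierTruncate_le (Lp.memLp y) N

/-- Bessel: `‖cutLp N y‖ ≤ ‖y‖`. -/
theorem norm_cutLp_le (N : ℕ) (y : V2) : ‖cutLp N y‖ ≤ ‖y‖ :=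
  (pow_le_pow_iff_left₀ (norm_nonneg _) (norm_nonneg _) two_ne_zero).mp (norm_cutLp_sq_le N y)

/-- The cut has no Fourier modes outside the ball. -/
theorem mFourierCoeff_cutLp_eq_zero (N : ℕ) (y : V2) :
    ∀ l ∉ Torus.freqBall N, UnitAddTorus.mFourierCoeff (EuclideanSpace.complexify ∘ Torus.fourierTruncate N (y : VF)) l = 0 := by
  intro l hl
  rw [Torus.mFourierCoeff_fourierTruncate ((Lp.memLp y).integrable one_le_two) N l, if_neg hl]

/-- `⟪y, P y⟫ = ‖P y‖²`: the cut is an orthogonal projection. -/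
theorem inner_cutLp_self (N : ℕ) (y : V2) : ⟪y, cutLp N y⟫_ℝ = ‖cutLp N y‖ ^ 2 := by
  rw [MeasureTheory.L2.inner_def, norm_cutLp_sq]
  have h1 : ∫ x, ⟪(y : VF) x, ((cutLp N y : V2) : VF) x⟫_ℝ = ∫ x, ⟪(y : VF) x, Torus.fourierTruncate N (y : VF) x⟫_ℝ :=
    integral_congr_ae (by filter_upwards [coeFn_cutLp N y] with x hx; rw [hx])
  rw [h1, ← Torus.integral_inner_fourierTruncate_eq (Lp.memLp y) (Torus.memLp_fourierTruncate N _ 2) (mFourierCoeff_cutLp_eq_zero N y)]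
  exact integral_congr_ae (Filter.Eventually.of_forall fun x => real_inner_self_eq_norm_sq _)

/-- Pythagoras for the cut: `‖y − P y‖² = ‖y‖² − ‖P y‖²`. -/
theorem norm_sub_cutLp_sq (N : ℕ) (y : V2) : ‖y - cutLp N y‖ ^ 2 = ‖y‖ ^ 2 - ‖cutLp N y‖ ^ 2 := by
  rw [@norm_sub_sq_real, inner_cutLp_self]; ring

/-- The Plancherel split `‖y‖² = ‖P y‖² + ‖y − P y‖²` (the form in which S3d′ `stub_fastContentL` is stated). -/
theorem norm_sq_eq_cut_split (N : ℕ) (y : V2) : ‖y‖ ^ 2 = ‖cutLp N y‖ ^ 2 + ‖y - cutLp N y‖ ^ 2 := by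
  rw [norm_sub_cutLp_sq]; ring

/-- The cut of a weakly divergence-free class is weakly divergence free. -/
theorem isWeaklyDivFree_cutLp (N : ℕ) {y : V2} (hy : Torus.IsWeaklyDivFree (y : VF)) :
    Torus.IsWeaklyDivFree ((cutLp N y : V2) : VF) :=
  (Torus.IsDivFree.isWeaklyDivFree_holds (Torus.isSmooth_fourierTruncate N _)
    (Torus.isDivFree_fourierTruncate (Lp.memLp y) hy N)).congr_ae (coeFn_cutLp N y).symm

/-- The datum class is the datum, a.e. -/
theorem coeFn_datumLp (w₀ : VF) (hw₀ : IsDatum w₀) : ((datumLp w₀ hw₀ : V2) : VF) =ᵐ[volume] w₀ :=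
  MemLp.coeFn_toLp _

/-- `‖datum‖² = vectorL2Sq w₀` (the quantity `drop` is measured against). -/
theorem norm_datumLp_sq (w₀ : VF) (hw₀ : IsDatum w₀) : ‖datumLp w₀ hw₀‖ ^ 2 = Torus.vectorL2Sq w₀ :=
  norm_toLp_sq _

/-- The datum class is weakly divergence free. -/
theorem isWeaklyDivFree_datumLp (w₀ : VF) (hw₀ : IsDatum w₀) : Torus.IsWeaklyDivFree ((datumLp w₀ hw₀ : V2) : VF) :=
  hw₀.2.2.congr_ae (coeFn_datumLp w₀ hw₀).symm

end OneLevelSplit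

end

end Summit.AnomalousDissipation.AnomalousDissipation.Theorems.SolenoidalFractalHomogenisation.LagrangianStep
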